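import Literature.AlgebraicGeometry.Resolution.LipmanValuativeQuadraticSequenceProofs
import HarnessLib

/-!
# The local ring of a blowing up at the centre of a valuation, general centre: the local blowing up along the stalk of the centre

Topic: `Literature/AlgebraicGeometry/Resolution`. Folklore blow-up algebra (Stacks 0804), the GENERAL-CENTRE companion of
`IsBlowup.exists_point_range_eq_locAtCentre_blowupRing` (`LipmanValuativeQuadraticSequenceProofs.lean`, centre `J_s = 𝔪_s`) and of
`IsBlowup.isQuadraticTransformAlong_range_stalkEmb` (`BlowupStalkQuadraticTransform.lean`). Let `π : X' → X` be a blowing up along `J`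
(`IsBlowup π J`, `Blowups.lean`) of an integral locally Noetherian scheme, `s ∈ X`, `J_s = (c_1, …, c_m)`, `F : K(X) → K` a field
homomorphism reading `𝒪_{X,s}` inside `K` with image `R ⊆ O` DOMINATED by the valuation ring `O` of `K`, and `c_j` a generator whose image
is non-zero of maximal value (`ν(c_i) ≥ ν(c_j)` for all `i`; Novacoski–Spivakovsky 2014, Def. 2.11: "along an ideal `I = (u₀, …, u_q)`
with `ν(u₀)` minimal, `R' = R[u₁/u₀, …, u_q/u₀]`"). Then:

* `IsBlowup.range_comp_stalkEmb_of_chart_closure` — for a point `x'` carried by the `c_j`-chart `Spec B_j → X'` at the centre of `O`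
  on `B_j`, the image of `𝒪_{X',x'}` in `K` (through the canonical embedding `ε_{x'}` into `K(X)`, `BlowupStalkEmbedding.lean`, and `F`)
  is `(R[c_i/c_j : i])_{𝔪_O ∩ R[c_i/c_j : i]}` (`locAtCentre (Subring.closure (R ∪ {c_i/c_j})) O`, `LocalBlowup.lean`) — the proof of
  `IsBlowup.range_comp_stalkEmb_of_chart` with `range_chartToField` in place of `range_chartToField_eq_blowupRing`;
* `IsBlowup.exists_point_range_eq_locAtCentre_closure` — **SOME point `x' ∈ X'` over `s` has this local ring**: the centre of `O` on the
  `c_j`-chart (`chartCentre`, `QuadraticTransformAlongPrime.lean`) mapped to `X'` by `IsBlowup.exists_chart_morphism_of_index`; i.e. the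
  local ring of `X'` at that point IS the local blowing up of `R` along `(c)` with respect to `O` (`IsLocalBlowupAlong`, NSp Def. 2.11).
  When `s ∉ V(J)` one may take `c = (1)`: the local ring is unchanged.

Motivation (cell decomp-res, crux `CleanModels` stmt-ResolutionOfSingularities-15917, hand-2 g6): the one-step dictionary of the
scheme-to-local extraction of a sequence of blow-ups in regular centres (Cossart–Jannsen–Saito 2020, Thm. 1.4) along a valuation.
HONEST FRAMING: folklore (Stacks 0804) assembled over the tree's chart kit; nothing of [CossartJannsenSaito2020] is proved here.

## Sources

* The Stacks Project, Tag 0804 (affine charts of a blowing up), Tag 0805. [StacksProject]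
* J. Novacoski, M. Spivakovsky, arXiv:1204.4751, Def. 2.11 (local blowing up along an ideal). [NovacoskiSpivakovsky2014]
-/

noncomputable section

open IsLocalRing AlgebraicGeometry CategoryTheory

namespace Literature.AlgebraicGeometry.Resolution

universe u

open Scheme.IdealSheafData Limits

variable {X' X : Scheme.{u}} {π : X' ⟶ X} {J : X.IdealSheafData}
variable [IsIntegral X] [IsLocallyNoetherian X] {K : Type u} [Field K] (O : ValuationSubring K)

set_option maxHeartbeats 800000 in
-- `IsLocalization.ringHom_ext` over the chart ring unifies large instance terms (as in `IsBlowup.range_comp_stalkEmb_of_chart`)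
/-- **The local ring of the blowing up at a point of the `c_j`-chart through the centre of `O`, read in `K` — general centre.**
Let `x' ∈ X'` lie over `s`, let `c₁, …, c_m` generate `J_s`, let `θ : 𝒪_{X,s} → K` (the restriction of `F : K(X) → K`) take values in
`O` with `θ(c_j) ≠ 0` of maximal value, and let `q : Spec B_j → X'` be a chart through `x' = q(𝔴)` at the centre `𝔴` of `O` on `B_j`
(`chartCentre`). Then the image of `𝒪_{X',x'}` in `K` is the localised chart ring `(θ(𝒪_{X,s})[θ(c_i)/θ(c_j) : i])_{𝔪_O}`.
[cite: StacksProject, Tag 0804] -/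
theorem IsBlowup.range_comp_stalkEmb_of_chart_closure (hπ : IsBlowup π J) (x' : X') (s : X)
    (hs : π x' = s) {m : ℕ} (c : Fin m → X.presheaf.stalk s) (j : Fin m)
    (F : X.functionField →+* K) (θ : X.presheaf.stalk s →+* K)
    (hFθ : F.comp (algebraMap (X.presheaf.stalk s) X.functionField) = θ)
    (hθ : θ (c j) ≠ 0) (hRO : ∀ r, θ r ∈ O)
    (hmin : ∀ i, O.valuation (θ (c i)) ≤ O.valuation (θ (c j)))
    (q : Spec (.of (chartRing c j)) ⟶ X') (w : Spec (.of (chartRing c j)))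
    (hw : w.asIdeal = chartCentre c j θ hθ O hRO hmin)
    (hq : q w = x') [IsIso (q.stalkMap w)]
    (hsq : q ≫ π = Spec.map (CommRingCat.ofHom (chartBase c j)) ≫ X.fromSpecStalk s) :
    (F.comp (hπ.stalkEmb x')).range =
      locAtCentre (Subring.closure (Set.range θ ∪ Set.range fun i => θ (c i) / θ (c j))) O := by
  subst hs
  obtain rfl : w = ⟨chartCentre c j θ hθ O hRO hmin, inferInstance⟩ := PrimeSpectrum.ext hw
  obtain ⟨χ, hχ, hloc, -⟩ :=
    exists_stalk_ringHom_of_chart π x' (CommRingCat.ofHom (chartBase c j)) q _ hq hsq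
  letI : Algebra (chartRing c j) (X'.presheaf.stalk x') := χ.toAlgebra
  haveI : IsLocalization.AtPrime (X'.presheaf.stalk x') (chartCentre c j θ hθ O hRO hmin) := hloc
  have hθa : ∀ a, F (hπ.stalkEmb x' (χ (chartBase c j a))) = θ a := by
    intro a
    have h1 : χ (chartBase c j a) = (π.stalkMap x').hom a := hχ a
    rw [h1, hπ.stalkEmb_stalkMap, ← hFθ]
    rfl
  have h2 : (F.comp (hπ.stalkEmb x')).comp (algebraMap (chartRing c j) (X'.presheaf.stalk x')) =
      chartToField c j θ hθ := by
    refine ringHom_ext_chartBase c j ?_ ?_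
    · ext a
      change F (hπ.stalkEmb x' (χ (chartBase c j a))) = chartToField c j θ hθ (chartBase c j a)
      rw [chartToField_reesChartBase, hθa]
    · change F (hπ.stalkEmb x' (χ (chartBase c j (c j)))) ≠ 0
      rw [hθa]
      exact hθ
  have h3 : ∀ b, locToField c j θ hθ O hRO hmin (X'.presheaf.stalk x')
      (algebraMap (chartRing c j) (X'.presheaf.stalk x') b) = chartToField c j θ hθ b :=
    fun b => locToField_algebraMap c j θ hθ O hRO hmin (X'.presheaf.stalk x') b
  have hg : F.comp (hπ.stalkEmb x') = locToField c j θ hθ O hRO hmin (X'.presheaf.stalk x') := by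
    refine IsLocalization.ringHom_ext (chartCentre c j θ hθ O hRO hmin).primeCompl ?_
    rw [h2]
    refine RingHom.ext fun b => ?_
    rw [RingHom.comp_apply, h3]
  rw [hg, range_locToField, range_chartToField]

/-- The valuation of the image of an element of an ideal is bounded by the maximal valuation of the images of its generators. [folklore] -/
private theorem valuation_le_of_mem_span' {A : Type*} [CommRing A] (θ : A →+* K)
    (hRO : ∀ r, θ r ∈ O) {m : ℕ} (c : Fin m → A) (j : Fin m)
    (hmin : ∀ i, O.valuation (θ (c i)) ≤ O.valuation (θ (c j))) {r : A}
    (hr : r ∈ Ideal.span (Set.range c)) : O.valuation (θ r) ≤ O.valuation (θ (c j)) := by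
  induction hr using Submodule.span_induction with
  | mem y hy =>
    obtain ⟨i, rfl⟩ := hy
    exact hmin i
  | zero => simp
  | add y z _ _ hy hz =>
    rw [map_add]
    exact (Valuation.map_add _ _ _).trans (max_le hy hz)
  | smul a y _ hy =>
    rw [smul_eq_mul, map_mul, map_mul]
    calc O.valuation (θ a) * O.valuation (θ y) ≤ 1 * O.valuation (θ (c j)) :=
          mul_le_mul' ((O.valuation_le_one_iff _).mpr (hRO a)) hy
      _ = O.valuation (θ (c j)) := one_mul _

/-- **The general-centre blow-up half of the blow-up / valuation dictionary.** Let `π : X' → X` be a blowing up along `J` of an integral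
locally Noetherian scheme, `s ∈ X` with `J_s = (c_1, …, c_m)`, `F : K(X) → K` a field homomorphism whose restriction `θ` to `𝒪_{X,s}` takes
values in the valuation ring `O` and is DOMINATED by it (`𝔪_s ↦` positive values), and `c_j` a generator with `θ(c_j) ≠ 0` of maximal
value. Then SOME point `x' ∈ X'` over `s` has local ring, read in `K` through the canonical embedding `ε_{x'} : 𝒪_{X',x'} ↪ K(X)` and `F`,
equal to the localised chart ring `(θ(𝒪_{X,s})[θ(c_i)/θ(c_j) : i])_{𝔪_O ∩ …}` — the local blowing up of `θ(𝒪_{X,s})` along `(c)` with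
respect to `O` (Novacoski–Spivakovsky 2014, Def. 2.11). (Compatibility `F ∘ ε_{x'} ∘ π^♯_{x'} = F ∘ (𝒪_{X,π x'} ⊆ K(X))` is
`IsBlowup.stalkEmb_stalkMap`; injectivity is `IsBlowup.stalkEmb_injective`.)
[cite: StacksProject, Tag 0804] [cite: NovacoskiSpivakovsky2014, Def. 2.11] -/
theorem IsBlowup.exists_point_range_eq_locAtCentre_closure (hπ : IsBlowup π J) (s : X) {m : ℕ}
    (c : Fin m → X.presheaf.stalk s) (hc : Ideal.span (Set.range c) = stalkIdeal J s) (j : Fin m)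
    (F : X.functionField →+* K) (θ : X.presheaf.stalk s →+* K)
    (hFθ : F.comp (algebraMap (X.presheaf.stalk s) X.functionField) = θ)
    (hRO : ∀ r, θ r ∈ O) (hdom : ∀ r ∈ maximalIdeal (X.presheaf.stalk s), O.valuation (θ r) < 1)
    (hθ : θ (c j) ≠ 0) (hmin : ∀ i, O.valuation (θ (c i)) ≤ O.valuation (θ (c j))) :
    ∃ x' : X', π x' = s ∧
      (F.comp (hπ.stalkEmb x')).range =
        locAtCentre (Subring.closure (Set.range θ ∪ Set.range fun i => θ (c i) / θ (c j))) O := by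
  classical
  -- the chart at `c j` and the centre of `O` on it
  obtain ⟨q, hqiso, hsq⟩ := hπ.exists_chart_morphism_of_index s c hc j
  let w : Spec (.of (chartRing c j)) := ⟨chartCentre c j θ hθ O hRO hmin, inferInstance⟩
  haveI := hqiso w
  -- the point `x' = q 𝔴` lies over `s`
  have hpt : Spec.map (CommRingCat.ofHom (chartBase c j)) w = closedPoint (X.presheaf.stalk s) :=
    PrimeSpectrum.ext (comap_reesChartBase_chartCentre c j θ hθ O hRO hmin hdom)
  have hs : π (q w) = s := by
    rw [← Scheme.Hom.comp_apply, hsq, Scheme.Hom.comp_apply, hpt]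
    exact Scheme.fromSpecStalk_closedPoint
  exact ⟨q w, hs, hπ.range_comp_stalkEmb_of_chart_closure O (q w) s hs c j F θ hFθ hθ hRO hmin q w rfl rfl hsq⟩

/-- **Off the centre the local ring is unchanged**: if `s ∉ V(J)` (`J_s = 𝒪_{X,s}`), some point `x' ∈ X'` over `s` has
`F(ε_{x'}(𝒪_{X',x'})) = (θ(𝒪_{X,s}))_{𝔪_O ∩ θ(𝒪_{X,s})}` (`= θ(𝒪_{X,s})` when the latter is dominated by `O`). [cite: StacksProject, Tag 0804] -/
theorem IsBlowup.exists_point_range_eq_locAtCentre_of_stalkIdeal_eq_top (hπ : IsBlowup π J) (s : X)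
    (hJ : stalkIdeal J s = ⊤)
    (F : X.functionField →+* K) (θ : X.presheaf.stalk s →+* K)
    (hFθ : F.comp (algebraMap (X.presheaf.stalk s) X.functionField) = θ)
    (hRO : ∀ r, θ r ∈ O) (hdom : ∀ r ∈ maximalIdeal (X.presheaf.stalk s), O.valuation (θ r) < 1) :
    ∃ x' : X', π x' = s ∧ (F.comp (hπ.stalkEmb x')).range = locAtCentre θ.range O := by
  let c : Fin 1 → X.presheaf.stalk s := fun _ => 1
  have hc : Ideal.span (Set.range c) = stalkIdeal J s := by
    have h1 : (1 : X.presheaf.stalk s) ∈ Ideal.span (Set.range c) := Ideal.subset_span ⟨0, rfl⟩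
    rw [hJ]
    exact (Ideal.eq_top_iff_one _).mpr h1
  have hθ1 : θ (c 0) ≠ 0 := by
    change θ 1 ≠ 0
    rw [map_one]; exact one_ne_zero
  have hmin : ∀ i, O.valuation (θ (c i)) ≤ O.valuation (θ (c 0)) := fun i => by
    obtain rfl : i = 0 := Subsingleton.elim _ _
    exact le_rfl
  obtain ⟨x', hx', hrange⟩ :=
    hπ.exists_point_range_eq_locAtCentre_closure O s c hc 0 F θ hFθ hRO hdom hθ1 hmin
  refine ⟨x', hx', ?_⟩
  rw [hrange]
  congr 1
  -- `closure (θ(R) ∪ {1}) = θ(R)`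
  apply le_antisymm
  · rw [Subring.closure_le]
    rintro z (⟨r, rfl⟩ | ⟨i, rfl⟩)
    · exact ⟨r, rfl⟩
    · change θ 1 / θ 1 ∈ θ.range
      rw [map_one, div_one]
      exact θ.range.one_mem
  · intro z hz
    exact Subring.subset_closure (Or.inl hz)

end Literature.AlgebraicGeometry.Resolution

end
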